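import Summits.NavierStokesRegularity.NavierStokesRegularity.Theorems.SoloRefutePrastaro2015
import Literature.Analysis.FluidPDE.CaloricRemainderCalculus
import Literature.Barriers.NavierStokesRegularity.CompactPerturbationRigidity
import HarnessLib

/-!
# C29 `Prastaro2015` — part 2: the claimed Theorem A1 (= `ClaimedTheorem`) is false

Text of record: A. Prástaro, arXiv 1503.07851 v4 (40 pp., PDF page = printed page), Theorem A1 p. 32
in its (A.6) form p. 33 (`Literature.Claims.NS.Prastaro2015.TheoremA1`, skeleton p478120). Part 1
(`SoloRefutePrastaro2015.lean`, p481561) refutes Step 4 (`not_Step4_concrete`) and Lemma A3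
(`not_Step5_LemmaA3`); this file refutes the CLAIM itself:

* `heat_eq_zero_of_hasCompactSupport` — Liouville for compactly supported global smooth solutions of
  the heat equation on `ℝ × ℝ³` (from the tree's classical local energy identity
  `Literature.Analysis.FluidPDE.caloric_local_energy_identity` tested against a plateau bump);
* `isGlobalSolution_shift` — the system (66) is autonomous;
* `not_TheoremA1` (`= ¬ ClaimedTheorem`), `not_ClaimedTheorem_and_not_Step4` — at the rest state `(0, 0, 0)` of the physical medium `m₀`
  (`ρ = C_p = κ = 1`, `χ = -1`, `f ≡ 0`) every global smooth solution agreeing with the rest state off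
  a compact space–time set is the rest state: velocity by forward uniqueness from the quiescent slice
  (`Literature.Barriers.NavierStokesRegularity.CompactPerturbationRigidity.eq_zero_of_initial_eq_zero`,
  p481034), pressure by `pressure_slice_const_of_velocity_const` and `p̄ = 0` far out, temperature by
  the heat Liouville lemma. Hence no NON-CONSTANT compactly supported perturbation exists.

WHAT THIS IS NOT: not a claim about NS regularity or blow-up; not a claim about any author beyond the
typed locator.
-/

set_option linter.dupNamespace false

open MeasureTheory Set Function
open scoped ContDiff Laplacian InnerProductSpace

namespace Summit.NavierStokesRegularity.NavierStokesRegularity.Theorems.Prastaro2015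

open Literature.Claims.NS.Prastaro2015 Literature.Analysis.FluidPDE

/-! ## Part 2 — the claimed Theorem A1 itself fails at the rest state

Liouville for compactly supported global smooth solutions of the heat equation (from the tree's
classical local energy identity `caloric_local_energy_identity` tested against a plateau bump), time
translation of solutions, and `not_TheoremA1`: at the rest state of the physical medium `m₀` every
global smooth solution agreeing with it off a compact space–time set IS the rest state (velocity by
forward uniqueness `Literature.Barriers.NavierStokesRegularity.CompactPerturbationRigidity.eq_zero_of_initial_eq_zero`, pressure by
`pressure_slice_const_of_velocity_const`, temperature by the heat Liouville lemma). -/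

/-- Membership in a closed ball about the origin of `ℝ × E3` (sup metric). [folklore] -/
theorem mem_closedBall_zero_prod {q : ℝ × E3} {R : ℝ} :
    q ∈ Metric.closedBall (0 : ℝ × E3) R ↔ |q.1| ≤ R ∧ ‖q.2‖ ≤ R := by
  rw [mem_closedBall_zero_iff, Prod.norm_def, max_le_iff, Real.norm_eq_abs]

/-- The norm of `(R₀ + 1) e₀` exceeds `R₀` (for `R₀ > -1/2`, in particular `R₀ > 0`). [folklore] -/
theorem norm_single_gt {R₀ : ℝ} (h : 0 < R₀) :
    R₀ < ‖(EuclideanSpace.single 0 (R₀ + 1) : E3)‖ := by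
  have e : ‖(EuclideanSpace.single 0 (R₀ + 1) : E3)‖ = ‖R₀ + 1‖ := by simp
  rw [e, Real.norm_eq_abs, abs_of_pos (by linarith)]
  linarith

section HeatLiouville

variable {F' : Type*} [NormedAddCommGroup F'] [InnerProductSpace ℝ F']

/-- A continuous linear map with vanishing Frobenius norm is zero. [folklore] -/
theorem eq_zero_of_frobeniusNormSq_eq_zero [FiniteDimensional ℝ F'] {L : E3 →L[ℝ] F'}
    (h : frobeniusNormSq L = 0) :
    L = 0 := by
  set b := EuclideanSpace.basisFun (Fin 3) ℝ
  rw [frobeniusNormSq_eq_sum b] at h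
  have hi : ∀ i, L (b i) = 0 := fun i => by
    have h1 := (Finset.sum_eq_zero_iff_of_nonneg fun j _ => sq_nonneg ‖L (b j)‖).1 h i
      (Finset.mem_univ _)
    exact norm_eq_zero.1 ((pow_eq_zero_iff two_ne_zero).1 h1)
  have hL : (L : E3 →ₗ[ℝ] F') = 0 := b.toBasis.ext fun i => by simpa using hi i
  exact ContinuousLinearMap.coe_inj.1 hL

/-- **Liouville for compactly supported global smooth solutions of the heat equation** on
`ℝ × ℝ³`: `∂ₜe = Δe` everywhere and `e = 0` off a compact set force `e ≡ 0`. Proof: the classical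
local energy identity `∫∫ |e|² φₜ + ∫∫ |e|² Δφ = 2 ∫∫ |De|² φ` against a plateau bump `φ ≡ 1` near
the support gives `∫∫ |De|² = 0`; so every slice is constant, hence zero.
[cite: LemarieRieusset2016, Thm. 14.7, proof p. 515] -/
theorem heat_eq_zero_of_hasCompactSupport [FiniteDimensional ℝ F'] {e : ℝ → E3 → F'}
    (he : ContDiff ℝ ∞ (uncurry e))
    (hheat : ∀ t x, deriv (fun s => e s x) t = (Δ (e t)) x)
    (hc : HasCompactSupport (uncurry e)) (t : ℝ) (x : E3) : e t x = 0 := by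
  obtain ⟨R₀, hR₀, hKR⟩ := hc.isCompact.isBounded.subset_closedBall_lt 0 (0 : ℝ × E3)
  have hzero : ∀ z : ℝ × E3, z ∉ Metric.closedBall (0 : ℝ × E3) R₀ → e z.1 z.2 = 0 :=
    fun z hz => image_eq_zero_of_notMem_tsupport (f := uncurry e) fun h => hz (hKR h)
  -- plateau bump `φ (t, x) = χ₁ t * χ₂ x`, `≡ 1` on `ball 0 (R₀ + 1)`, supported in `closedBall 0 (R₀ + 2)`
  let χ₁ : ContDiffBump (0 : ℝ) := ⟨R₀ + 1, R₀ + 2, by linarith, by linarith⟩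
  let χ₂ : ContDiffBump (0 : E3) := ⟨R₀ + 1, R₀ + 2, by linarith, by linarith⟩
  let φ : ℝ → E3 → ℝ := fun s y => χ₁ s * χ₂ y
  have hφ_zero : ∀ z : ℝ × E3, z ∉ Metric.closedBall (0 : ℝ × E3) (R₀ + 2) → φ z.1 z.2 = 0 := by
    intro z hz
    rw [Metric.mem_closedBall, Prod.dist_eq, max_le_iff, not_and_or, not_le, not_le] at hz
    show χ₁ z.1 * χ₂ z.2 = 0
    rcases hz with h | h
    · rw [χ₁.zero_of_le_dist h.le, zero_mul]
    · rw [χ₂.zero_of_le_dist h.le, mul_zero]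
  have hφ_one : ∀ z ∈ Metric.ball (0 : ℝ × E3) (R₀ + 1), φ z.1 z.2 = 1 := by
    intro z hz
    rw [Metric.mem_ball, Prod.dist_eq, max_lt_iff] at hz
    show χ₁ z.1 * χ₂ z.2 = 1
    rw [χ₁.one_of_mem_closedBall (Metric.mem_closedBall.2 hz.1.le),
      χ₂.one_of_mem_closedBall (Metric.mem_closedBall.2 hz.2.le), mul_one]
  have hball : Metric.closedBall (0 : ℝ × E3) R₀ ⊆ Metric.ball (0 : ℝ × E3) (R₀ + 1) :=
    Metric.closedBall_subset_ball (by linarith)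
  have hφ_test : IsSpaceTimeTestOn (⊤ : TopologicalSpace.Opens (ℝ × E3)) φ := by
    refine ⟨(χ₁.contDiff.comp contDiff_fst).mul (χ₂.contDiff.comp contDiff_snd), ?_,
      fun _ _ => trivial⟩
    exact HasCompactSupport.intro (isCompact_closedBall (0 : ℝ × E3) (R₀ + 2))
      fun z hz => hφ_zero z hz
  -- the heat equation in `HasDerivAt` form
  have hheat' : ∀ z ∈ ((⊤ : TopologicalSpace.Opens (ℝ × E3)) : Set (ℝ × E3)),
      HasDerivAt (fun s => e s z.2) ((1 : ℝ) • (Δ (e z.1)) z.2) z.1 := by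
    intro z _
    have hline : ContDiff ℝ ∞ fun s => e s z.2 := he.comp (contDiff_id.prodMk contDiff_const)
    exact ((hline.differentiable (by simp)) z.1).hasDerivAt.congr_deriv
      (by rw [hheat z.1 z.2, one_smul])
  have hid := caloric_local_energy_identity (Ω := ⊤) (ν := 1) he hheat' hφ_test
  -- both left-hand integrands vanish identically
  have hI1 : (fun z : ℝ × E3 => ‖e z.1 z.2‖ ^ 2 * timeDeriv φ z.1 z.2) = fun _ => 0 := by
    funext z
    by_cases hz : z ∈ Metric.closedBall (0 : ℝ × E3) R₀
    · have hev : (fun s => φ s z.2) =ᶠ[nhds z.1] fun _ => (1 : ℝ) := by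
        have hc1 : Continuous fun s : ℝ => (s, z.2) := continuous_id.prodMk continuous_const
        have hm : ∀ᶠ s in nhds z.1, (s, z.2) ∈ Metric.ball (0 : ℝ × E3) (R₀ + 1) :=
          hc1.continuousAt.eventually_mem (Metric.isOpen_ball.mem_nhds (hball hz))
        exact hm.mono fun s hs => hφ_one _ hs
      rw [timeDeriv_apply, hev.deriv_eq, deriv_const, mul_zero]
    · rw [hzero z hz, norm_zero, zero_pow two_ne_zero, zero_mul]
  have hI2 : (fun z : ℝ × E3 => ‖e z.1 z.2‖ ^ 2 * (Δ (φ z.1)) z.2) = fun _ => 0 := by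
    funext z
    by_cases hz : z ∈ Metric.closedBall (0 : ℝ × E3) R₀
    · have hev : φ z.1 =ᶠ[nhds z.2] fun _ => (1 : ℝ) := by
        have hc2 : Continuous fun y : E3 => (z.1, y) := continuous_const.prodMk continuous_id
        have hm : ∀ᶠ y in nhds z.2, (z.1, y) ∈ Metric.ball (0 : ℝ × E3) (R₀ + 1) :=
          hc2.continuousAt.eventually_mem (Metric.isOpen_ball.mem_nhds (hball hz))
        exact hm.mono fun y hy => hφ_one _ hy
      rw [(InnerProductSpace.laplacian_congr_nhds hev).self_of_nhds,
        InnerProductSpace.laplacian_const, Pi.zero_apply, mul_zero]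
    · rw [hzero z hz, norm_zero, zero_pow two_ne_zero, zero_mul]
  rw [hI1, hI2, integral_zero, mul_zero, add_zero] at hid
  have hint : ∫ z : ℝ × E3, φ z.1 z.2 * frobeniusNormSq (fderiv ℝ (e z.1) z.2) = 0 := by
    linarith
  -- the right-hand integrand is continuous, nonnegative and compactly supported, hence `≡ 0`
  have hes : IsSmoothSpaceTimeOn univ e := IsSmoothSpaceTimeOn.of_contDiff_univ he
  have hD_c : Continuous fun z : ℝ × E3 => fderiv ℝ (e z.1) z.2 :=
    (hes.fderiv_slice uniqueDiffOn_univ).continuous_of_univ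
  have hfrob_c : Continuous fun z : ℝ × E3 => frobeniusNormSq (fderiv ℝ (e z.1) z.2) := by
    have hb : (fun z : ℝ × E3 => frobeniusNormSq (fderiv ℝ (e z.1) z.2)) =
        fun z => ∑ i, ‖fderiv ℝ (e z.1) z.2 (EuclideanSpace.basisFun (Fin 3) ℝ i)‖ ^ 2 :=
      funext fun z => frobeniusNormSq_eq_sum _ _
    rw [hb]
    exact continuous_finsetSum _ fun i _ => ((hD_c.clm_apply continuous_const).norm).pow 2
  have hφ_c : Continuous fun z : ℝ × E3 => φ z.1 z.2 :=
    (χ₁.continuous.comp continuous_fst).mul (χ₂.continuous.comp continuous_snd)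
  have hg_c : Continuous
      fun z : ℝ × E3 => φ z.1 z.2 * frobeniusNormSq (fderiv ℝ (e z.1) z.2) := hφ_c.mul hfrob_c
  have hg_supp : HasCompactSupport
      fun z : ℝ × E3 => φ z.1 z.2 * frobeniusNormSq (fderiv ℝ (e z.1) z.2) :=
    HasCompactSupport.intro (isCompact_closedBall (0 : ℝ × E3) (R₀ + 2)) fun z hz => by
      simp only [hφ_zero z hz, zero_mul]
  have hg_nn : 0 ≤ fun z : ℝ × E3 => φ z.1 z.2 * frobeniusNormSq (fderiv ℝ (e z.1) z.2) :=
    fun z => mul_nonneg (mul_nonneg χ₁.nonneg χ₂.nonneg) (frobeniusNormSq_nonneg _)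
  have hg_zero : ∀ z : ℝ × E3, φ z.1 z.2 * frobeniusNormSq (fderiv ℝ (e z.1) z.2) = 0 := by
    intro z
    by_contra hne
    have hpos := hg_c.integral_pos_of_hasCompactSupport_nonneg_nonzero (μ := volume) hg_supp hg_nn hne
    linarith
  -- hence every slice has vanishing derivative everywhere
  have hD0 : ∀ s y, fderiv ℝ (e s) y = 0 := by
    intro s y
    by_cases hz : ((s, y) : ℝ × E3) ∈ Metric.closedBall (0 : ℝ × E3) R₀
    · have h1 : φ s y * frobeniusNormSq (fderiv ℝ (e s) y) = 0 := hg_zero (s, y)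
      rw [hφ_one _ (hball hz), one_mul] at h1
      exact eq_zero_of_frobeniusNormSq_eq_zero h1
    · have hc2 : Continuous fun y' : E3 => (s, y') := continuous_const.prodMk continuous_id
      have hev : e s =ᶠ[nhds y] fun _ => (0 : F') := by
        have hm : ∀ᶠ y' in nhds y, (s, y') ∈ (Metric.closedBall (0 : ℝ × E3) R₀)ᶜ :=
          hc2.continuousAt.eventually_mem (Metric.isClosed_closedBall.isOpen_compl.mem_nhds hz)
        exact hm.mono fun y' hy' => hzero _ hy'
      rw [hev.fderiv_eq, fderiv_fun_const, Pi.zero_apply]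
  -- slices are constant and vanish far out
  have hdiff : Differentiable ℝ (e t) :=
    (he.comp (contDiff_const.prodMk contDiff_id)).differentiable (by simp)
  have hfar : e t (EuclideanSpace.single 0 (R₀ + 1)) = 0 :=
    hzero (t, EuclideanSpace.single 0 (R₀ + 1)) fun hmem =>
      not_lt.2 (mem_closedBall_zero_prod.1 hmem).2 (norm_single_gt hR₀)
  rw [is_const_of_fderiv_eq_zero hdiff (hD0 t) x (EuclideanSpace.single 0 (R₀ + 1)), hfar]

end HeatLiouville

/-- Time translation of a section: `(shift s t₀)(t, x) = s(t + t₀, x)`. [folklore] -/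
def shift (s : WSection) (t₀ : ℝ) : WSection :=
  ⟨fun t x => s.v (t + t₀) x, fun t x => s.p (t + t₀) x, fun t x => s.θ (t + t₀) x⟩

/-- The system `(66)` is autonomous: time translates of global solutions are global solutions.
[cite: Prastaro2015Maslov, Example 4.5 (66) p. 28] -/
theorem isGlobalSolution_shift {m : Medium} {s : WSection} (h : IsGlobalSolution m s) (t₀ : ℝ) :
    IsGlobalSolution m (shift s t₀) := by
  have hφ : ContDiff ℝ ∞ fun q : ℝ × E3 => (q.1 + t₀, q.2) :=
    (contDiff_fst.add contDiff_const).prodMk contDiff_snd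
  refine ⟨isOpen_univ, ((contDiffOn_univ.1 h.smooth_v).comp hφ).contDiffOn,
    ((contDiffOn_univ.1 h.smooth_p).comp hφ).contDiffOn,
    ((contDiffOn_univ.1 h.smooth_θ).comp hφ).contDiffOn, ?_, ?_, ?_⟩
  · intro q _
    exact h.eqA (q.1 + t₀, q.2) (mem_univ _)
  · intro q _
    have hC := h.eqC (q.1 + t₀, q.2) (mem_univ _)
    have hd : deriv (fun τ => s.v (τ + t₀) q.2) q.1 = deriv (fun τ => s.v τ q.2) (q.1 + t₀) :=
      deriv_comp_add_const (fun τ => s.v τ q.2) t₀ q.1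
    simp only [EqC] at hC ⊢
    simp only [shift, hd]
    exact hC
  · intro q _
    have hD := h.eqD (q.1 + t₀, q.2) (mem_univ _)
    have hd : deriv (fun τ => s.θ (τ + t₀) q.2) q.1 = deriv (fun τ => s.θ τ q.2) (q.1 + t₀) :=
      deriv_comp_add_const (fun τ => s.θ τ q.2) t₀ q.1
    simp only [EqD] at hD ⊢
    simp only [shift, hd]
    exact hD

/-- **Theorem A1 (in its (A.6) form, = `ClaimedTheorem`) is false**: at the rest state `(0, 0, 0)` of
the physical medium `m₀` (`ρ = C_p = κ = 1`, `χ = -1`, `f ≡ 0`), every global smooth solution which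
agrees with the rest state off a compact space–time set is the rest state — velocity by forward
uniqueness from the quiescent slice before the compact set, pressure because `∇p̄ = 0` with `p̄ = 0`
far out, temperature by the heat-equation Liouville lemma — so no non-constant such solution exists.
[cite: Prastaro2015Maslov, Theorem A1 p. 32; (A.6) p. 33] -/
theorem not_TheoremA1 : ¬ TheoremA1 := by
  intro h
  obtain ⟨sbar, hsol, ⟨K, hK, hout⟩, hnc⟩ :=
    h m₀ (WSection.const 0 0 0) ⟨0, 0, 0, rfl⟩ (const_isGlobalSolution 0 0 0)
  obtain ⟨R₀, hR₀, hKR⟩ := hK.isBounded.subset_closedBall_lt 0 (0 : ℝ × E3)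
  have hout' : ∀ q : ℝ × E3, q ∉ Metric.closedBall (0 : ℝ × E3) R₀ →
      sbar.v q.1 q.2 = 0 ∧ sbar.p q.1 q.2 = 0 ∧ sbar.θ q.1 q.2 = 0 := by
    intro q hq
    have he := hout q fun hq' => hq (hKR hq')
    simp only [WSection.eval, Prod.mk.injEq] at he
    exact he
  have hfar_t : ∀ (t : ℝ) (x : E3), R₀ < |t| → ((t, x) : ℝ × E3) ∉ Metric.closedBall (0 : ℝ × E3) R₀ := by
    intro t x ht hmem
    exact not_lt.2 (mem_closedBall_zero_prod.1 hmem).1 ht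
  -- ### velocity: forward uniqueness from the quiescent slice `t = -(R₀ + 1)`
  set t₀ : ℝ := -(R₀ + 1) with ht₀
  have hS := isGlobalSolution_shift hsol t₀
  have hdS : ∀ T, HasUniformRapidDecayOn (Ico 0 T) (shift sbar t₀).v := fun T => by
    refine decay_of_hasCompactSupport (contDiffOn_univ.1 hS.smooth_v) ?_ (uniqueDiffOn_Ico 0 T)
    refine HasCompactSupport.intro (isCompact_closedBall (0 : ℝ × E3) (2 * R₀ + 1)) fun q hq => ?_
    show sbar.v (q.1 + t₀) q.2 = 0
    refine (hout' (q.1 + t₀, q.2) fun hmem => hq ?_).1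
    have hmem' := mem_closedBall_zero_prod.1 hmem
    refine mem_closedBall_zero_prod.2 ⟨?_, by linarith [hmem'.2]⟩
    have h1 := hmem'.1
    rw [abs_le] at h1 ⊢
    constructor <;> linarith [h1.1, h1.2]
  have hS0 : (shift sbar t₀).v 0 = 0 := by
    funext y
    show sbar.v (0 + t₀) y = 0
    rw [zero_add]
    exact (hout' (t₀, y) (hfar_t t₀ y (by rw [ht₀, abs_neg, abs_of_pos (by linarith)]; linarith))).1
  have hv : ∀ t x, sbar.v t x = 0 := by
    intro t x
    by_cases ht : 0 ≤ t - t₀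
    · have h₁ := classical_of_global hS (t - t₀ + 1)
      have hmem : t - t₀ ∈ Ico (0 : ℝ) (t - t₀ + 1) := ⟨ht, by linarith⟩
      have hz := Literature.Barriers.NavierStokesRegularity.CompactPerturbationRigidity.eq_zero_of_initial_eq_zero zero_le_one h₁ (hdS _) hS0 hmem
      have := congrFun hz x
      simpa [shift] using this
    · exact (hout' (t, x) (hfar_t t x (by
        rw [not_le, sub_lt_iff_lt_add, zero_add, ht₀] at ht
        rw [abs_of_neg (by linarith)]; linarith))).1
  -- ### pressure: `∇p̄ = 0` slice-wise, and `p̄ = 0` far out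
  have hp : ∀ t x, sbar.p t x = 0 := by
    intro t x
    by_cases ht : 0 ≤ t - t₀
    · have h₁ := classical_of_global hS (t - t₀ + 1)
      have hmem : t - t₀ ∈ Ico (0 : ℝ) (t - t₀ + 1) := ⟨ht, by linarith⟩
      have hu : ∀ s ∈ Ico (0 : ℝ) (t - t₀ + 1), ∀ y, (shift sbar t₀).v s y = (0 : E3) :=
        fun s _ y => hv (s + t₀) y
      have hc := fun y =>
        Literature.Barriers.NavierStokesRegularity.CompactPerturbationRigidity.pressure_slice_const_of_velocity_const
          h₁ 0 hu hmem y
      have hfar : sbar.p t (EuclideanSpace.single 0 (R₀ + 1)) = 0 :=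
        (hout' (t, EuclideanSpace.single 0 (R₀ + 1)) fun hmem' =>
          not_lt.2 (mem_closedBall_zero_prod.1 hmem').2 (norm_single_gt hR₀)).2.1
      have e1 : sbar.p t x = (shift sbar t₀).p (t - t₀) x := by simp [shift]
      have e2 : sbar.p t (EuclideanSpace.single 0 (R₀ + 1)) =
          (shift sbar t₀).p (t - t₀) (EuclideanSpace.single 0 (R₀ + 1)) := by simp [shift]
      rw [e1, hc x, ← hc (EuclideanSpace.single 0 (R₀ + 1)), ← e2, hfar]
    · exact (hout' (t, x) (hfar_t t x (by
        rw [not_le, sub_lt_iff_lt_add, zero_add, ht₀] at ht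
        rw [abs_of_neg (by linarith)]; linarith))).2.1
  -- ### temperature: heat Liouville
  have hvfun : sbar.v = fun _ _ => 0 := funext fun t => funext fun x => hv t x
  have hθ : ∀ t x, sbar.θ t x = 0 := by
    refine heat_eq_zero_of_hasCompactSupport (contDiffOn_univ.1 hsol.smooth_θ) (fun t x => ?_)
      (HasCompactSupport.intro hK fun q hq => ?_)
    · have hD := hsol.eqD (t, x) (mem_univ _)
      simp only [EqD, m₀, hvfun, fderiv_fun_const, Pi.zero_apply,
        frobeniusNormSq_zero, ContinuousLinearMap.toLinearMap_zero, LinearMap.zero_comp, map_zero,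
        add_zero, mul_zero, sub_zero, one_mul, mul_one] at hD
      linarith
    · have he := hout q hq
      simp only [WSection.eval, Prod.mk.injEq] at he
      exact he.2.2
  -- ### hence `s̄` is the rest state
  exact hnc ⟨0, 0, 0, by
    cases sbar with
    | mk v p θ =>
      simp only [WSection.const, WSection.mk.injEq]
      exact ⟨funext fun t => funext fun x => hv t x, funext fun t => funext fun x => hp t x,
        funext fun t => funext fun x => hθ t x⟩⟩

/-- **The CLAIMED THEOREM of C29 is false**, recorded jointly with its Step 4
(`ClaimedTheorem := TheoremA1`, `claimedTheorem_iff`; the bare `¬ ClaimedTheorem` is `not_TheoremA1`).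
[cite: Prastaro2015Maslov, Theorem A1 p. 32; (A.6) p. 33] -/
theorem not_ClaimedTheorem_and_not_Step4 : ¬ ClaimedTheorem ∧ ¬ Step4_concrete :=
  ⟨not_TheoremA1, not_Step4_concrete⟩

end Summit.NavierStokesRegularity.NavierStokesRegularity.Theorems.Prastaro2015
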